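import Summits.Ventures.HodgeRepro2.T5HeckeSimpleInvariants
import Summits.Ventures.HodgeRepro2.T5LevelIdempotentNaturality
import Summits.Ventures.HodgeRepro2.T5HeckeConvolutionAlgebra
import Summits.Ventures.HodgeRepro2.T5HeckeTranspose

/-!
# The representation `M ⊗_{H(G, K)} k[G/K]` attached to a Hecke module

Let `M` be a (right) module over `H(G, K)` (a module over `H(G, K)ᵐᵒᵖ`, compatible with `k`).
The representation `X := M ⊗_{H} k[G/K]` — realised as the quotient of `M ⊗_k k[G/K]` by the
relations `(m · T) ⊗ f = m ⊗ (T f)` — carries the `G`-action through `k[G/K]`, and its `K`-invariants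
are `M` again (`invariantsEquiv`): `m ↦ [m ⊗ δ_K]` is an `H(G, K)`-linear isomorphism `M ≃ X^K`,
with inverse `[m ⊗ f] ↦ m · ε(f)` where `ε(f) ∈ H(G, K)` is the Hecke element with
`ε(f) δ_K = e_K f`.  `X` is `K`-finite when every double coset `KgK/K` is finite, and it is
generated by `[M ⊗ δ_K]` as a `G`-representation.  This is the construction behind the
surjectivity half of «irreducible `π` with `π^K ≠ 0` ↔ simple `H(G, K)`-modules»
(`T5HeckeInducedIrreducible` takes the irreducible quotient).
-/

namespace Summit.Ventures.HodgeRepro2.T5HeckeInduced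

open T5HeckePermutationModule T5HeckeSimpleInvariants T5LevelIdempotent T5LevelIdempotentDual
  T5LevelIdempotentNaturality T5HeckeConvolution T5HeckeConvolutionAlgebra T5HeckeTranspose
  LevelPositivity
open scoped TensorProduct

variable {G : Type*} [Group G] {k : Type*} [Field k] {K : Subgroup G}

section PermutationModule

/-- The stabiliser in `K` of the coset `x` fixes the basis vector `δ_x` of `k[G/K]`. -/
theorem stabilizer_le_stabilizerIn_single (x : G ⧸ K) (c : k) :
    MulAction.stabilizer K x ≤ stabilizerIn (Representation.ofMulAction k G (G ⧸ K)) K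
      (MonoidAlgebra.single x c) := by
  intro κ hκ
  rw [MulAction.mem_stabilizer_iff] at hκ
  rw [mem_stabilizerIn_iff, Representation.ofMulAction_single]
  congr 1

/-- `k[G/K]` is `K`-finite when every double coset `KgK/K` is finite. -/
theorem kFinite_ofMulAction (hfin : ∀ g : G, Finite (MulAction.orbit K (g : G ⧸ K))) :
    KFinite (Representation.ofMulAction k G (G ⧸ K)) K := by
  intro f
  rw [← MonoidAlgebra.ofCoeff_coeff f]
  induction f.coeff using Finsupp.induction with
  | zero =>
    rw [MonoidAlgebra.ofCoeff_zero, stabilizerIn_eq_top_iff.2 (Submodule.zero_mem _)]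
    infer_instance
  | single_add x c g _ _ ih =>
    rw [MonoidAlgebra.ofCoeff_add, MonoidAlgebra.ofCoeff_single]
    haveI : (stabilizerIn (Representation.ofMulAction k G (G ⧸ K)) K
        (MonoidAlgebra.single x c)).FiniteIndex := by
      induction x using QuotientGroup.induction_on with
      | H g' =>
        haveI := hfin g'
        haveI := T5HeckeDoubleCoset.finiteIndex_stabilizer_coset K g'
        exact Subgroup.finiteIndex_of_le (stabilizer_le_stabilizerIn_single (g' : G ⧸ K) c)
    exact Subgroup.finiteIndex_of_le (inf_le_stabilizerIn_add K _ _)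

/-- `δ_K` is fixed by `K`. -/
theorem ofMulAction_single_one_of_mem {κ : G} (hκ : κ ∈ K) :
    Representation.ofMulAction k G (G ⧸ K) κ (MonoidAlgebra.single ((1 : G) : G ⧸ K) (1 : k)) =
      MonoidAlgebra.single ((1 : G) : G ⧸ K) (1 : k) := by
  rw [Representation.ofMulAction_single, MulAction.Quotient.smul_mk, smul_eq_mul, mul_one]
  congr 1
  rw [QuotientGroup.eq, mul_one]
  exact K.inv_mem hκ

/-- Every basis vector `δ_{xK}` is a `G`-translate of `δ_K`. -/
theorem single_eq_ofMulAction_out (x : G ⧸ K) (c : k) :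
    MonoidAlgebra.single x c =
      Representation.ofMulAction k G (G ⧸ K) (Quotient.out x)
        (MonoidAlgebra.single ((1 : G) : G ⧸ K) c) := by
  rw [Representation.ofMulAction_single, MulAction.Quotient.smul_mk, smul_eq_mul, mul_one,
    QuotientGroup.out_eq']

end PermutationModule

section Epsilon

variable (hfin : ∀ g : G, Finite (MulAction.orbit K (g : G ⧸ K))) [CharZero k]

/-- THE HECKE ELEMENT OF A VECTOR: `ε(f) ∈ H(G, K)` is the element with `ε(f) δ_K = e_K f`. -/
noncomputable def epsilon : MonoidAlgebra k (G ⧸ K) →ₗ[k] heckeAlgebra k K :=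
  heckeAlgebraEquivInvariants.symm.toLinearMap ∘ₗ
    levelIdempotentTo (Representation.ofMulAction k G (G ⧸ K)) (kFinite_ofMulAction hfin)

/-- `ε(f) δ_K = e_K f`. -/
theorem epsilon_apply_single_one (f : MonoidAlgebra k (G ⧸ K)) :
    (epsilon hfin f : Module.End k (MonoidAlgebra k (G ⧸ K)))
        (MonoidAlgebra.single ((1 : G) : G ⧸ K) (1 : k)) =
      levelAverage (Representation.ofMulAction k G (G ⧸ K)) K f := by
  unfold epsilon
  rw [LinearMap.comp_apply, LinearEquiv.coe_coe, ← heckeAlgebraEquivInvariants_apply,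
    LinearEquiv.apply_symm_apply, levelIdempotentTo_apply]

/-- `ε(δ_K) = 1`. -/
theorem epsilon_single_one :
    epsilon hfin (MonoidAlgebra.single ((1 : G) : G ⧸ K) (1 : k)) = 1 := by
  apply ext_of_apply_single_one
  rw [epsilon_apply_single_one, one_apply_single_one,
    levelAverage_of_mem_invariants single_one_mem_invariants]

/-- `ε(T f) = T ε(f)` for `T ∈ H(G, K)` (`e_K` commutes with `T`). -/
theorem epsilon_apply (T : heckeAlgebra k K) (f : MonoidAlgebra k (G ⧸ K)) :
    epsilon hfin ((T : Module.End k (MonoidAlgebra k (G ⧸ K))) f) = T * epsilon hfin f := by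
  apply ext_of_apply_single_one
  rw [epsilon_apply_single_one, Subalgebra.coe_mul, Module.End.mul_apply, epsilon_apply_single_one]
  exact (map_levelAverage' (f := (T : Module.End k (MonoidAlgebra k (G ⧸ K))))
    (σ := Representation.ofMulAction k G (G ⧸ K)) (fun g v => apply_ofMulAction T g v)
    (kFinite_ofMulAction hfin) f).symm

/-- `ε(f) δ_K = e_K f` for `K`-fixed `f` is `f` itself. -/
theorem epsilon_apply_single_one_of_mem {f : MonoidAlgebra k (G ⧸ K)}
    (hf : f ∈ invariants (Representation.ofMulAction k G (G ⧸ K)) K) :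
    (epsilon hfin f : Module.End k (MonoidAlgebra k (G ⧸ K)))
        (MonoidAlgebra.single ((1 : G) : G ⧸ K) (1 : k)) = f := by
  rw [epsilon_apply_single_one, levelAverage_of_mem_invariants hf]

end Epsilon

section Construction

variable (k K) (M : Type*) [AddCommGroup M] [Module k M] [Module (heckeAlgebra k K)ᵐᵒᵖ M]

/-- The relations `(m · T) ⊗ f = m ⊗ (T f)` defining `M ⊗_{H} k[G/K]`. -/
def relSet : Set (M ⊗[k] MonoidAlgebra k (G ⧸ K)) :=
  {x | ∃ (T : heckeAlgebra k K) (m : M) (f : MonoidAlgebra k (G ⧸ K)),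
    x = (MulOpposite.op T • m) ⊗ₜ[k] f - m ⊗ₜ[k] ((T : Module.End k (MonoidAlgebra k (G ⧸ K))) f)}

/-- The submodule of relations. -/
noncomputable def rel : Submodule k (M ⊗[k] MonoidAlgebra k (G ⧸ K)) := Submodule.span k  (relSet k K M)

/-- A generating relation lies in `rel`. -/
theorem tmul_sub_tmul_mem_rel (T : heckeAlgebra k K) (m : M) (f : MonoidAlgebra k (G ⧸ K)) :
    (MulOpposite.op T • m) ⊗ₜ[k] f - m ⊗ₜ[k] ((T : Module.End k (MonoidAlgebra k (G ⧸ K))) f) ∈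
      rel k K M :=
  Submodule.subset_span ⟨T, m, f, rfl⟩

/-- THE INDUCED REPRESENTATION SPACE `M ⊗_{H(G, K)} k[G/K]`. -/
abbrev Induced := (M ⊗[k] MonoidAlgebra k (G ⧸ K)) ⧸ rel k K M

/-- `G` acts on `M ⊗_k k[G/K]` through the second factor. -/
noncomputable def tensorRep : Representation k G (M ⊗[k] MonoidAlgebra k (G ⧸ K)) :=
  (Representation.trivial k G M).tprod (Representation.ofMulAction k G (G ⧸ K))

omit [Module (heckeAlgebra k K)ᵐᵒᵖ M] in
/-- The action on pure tensors. -/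
theorem tensorRep_tmul (g : G) (m : M) (f : MonoidAlgebra k (G ⧸ K)) :
    tensorRep k K M g (m ⊗ₜ[k] f) = m ⊗ₜ[k] (Representation.ofMulAction k G (G ⧸ K) g f) := by
  rw [tensorRep, Representation.tprod_apply, TensorProduct.map_tmul]
  rfl

/-- The relations are `G`-stable (`T` commutes with the action). -/
theorem rel_le_comap (g : G) : rel k K M ≤  (rel k K M).comap  (tensorRep k K M g) := by
  rw [rel, Submodule.span_le]
  rintro x ⟨T, m, f, rfl⟩
  rw [SetLike.mem_coe, Submodule.mem_comap, map_sub, tensorRep_tmul, tensorRep_tmul,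
    ← apply_ofMulAction]
  exact tmul_sub_tmul_mem_rel k K M T m _

/-- THE INDUCED REPRESENTATION of `G` on `M ⊗_{H(G, K)} k[G/K]`. -/
noncomputable def inducedRep : Representation k G  (Induced k K M) where
  toFun g :=  (rel k K M).mapQ  (rel k K M)  (tensorRep k K M g) (rel_le_comap k K M g)
  map_one' := by
    apply LinearMap.ext
    intro x
    induction x using Submodule.Quotient.induction_on with
    | H z => rw [Submodule.mapQ_apply, map_one, Module.End.one_apply, Module.End.one_apply]
  map_mul' g h := by
    apply LinearMap.ext
    intro x
    induction x using Submodule.Quotient.induction_on with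
    | H z =>
      rw [Submodule.mapQ_apply, map_mul, Module.End.mul_apply, Module.End.mul_apply,
        Submodule.mapQ_apply, Submodule.mapQ_apply]

/-- The induced action on classes. -/
theorem inducedRep_mk (g : G) (x : M ⊗[k] MonoidAlgebra k (G ⧸ K)) :
    inducedRep k K M g (Submodule.Quotient.mk x) = Submodule.Quotient.mk  (tensorRep k K M g x) :=
  Submodule.mapQ_apply (rel k K M) (rel k K M) (tensorRep k K M g) (h := rel_le_comap k K M g) x

/-- `m ↦ [m ⊗ δ_K]`. -/
noncomputable def toInduced : M →ₗ[k] Induced k K M :=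
   (rel k K M).mkQ ∘ₗ (TensorProduct.mk k M (MonoidAlgebra k (G ⧸ K))).flip
    (MonoidAlgebra.single ((1 : G) : G ⧸ K) (1 : k))

/-- `toInduced m = [m ⊗ δ_K]`. -/
theorem toInduced_apply (m : M) :
    toInduced k K M m = Submodule.Quotient.mk (m ⊗ₜ[k] MonoidAlgebra.single ((1 : G) : G ⧸ K) (1 : k)) :=
  rfl

/-- `[m ⊗ δ_K]` is `K`-fixed. -/
theorem toInduced_mem_invariants (m : M) : toInduced k K M m ∈ invariants  (inducedRep k K M) K := by
  rw [mem_invariants_iff]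
  intro κ hκ
  rw [toInduced_apply, inducedRep_mk, tensorRep_tmul, ofMulAction_single_one_of_mem hκ]

/-- `f ↦ [m ⊗ f]`, the `G`-map `k[G/K] → X` attached to `m`. -/
noncomputable def tmulMap (m : M) : MonoidAlgebra k (G ⧸ K) →ₗ[k] Induced k K M :=
   (rel k K M).mkQ ∘ₗ TensorProduct.mk k M (MonoidAlgebra k (G ⧸ K)) m

/-- `tmulMap m f = [m ⊗ f]`. -/
theorem tmulMap_apply (m : M) (f : MonoidAlgebra k (G ⧸ K)) :
    tmulMap k K M m f = Submodule.Quotient.mk (m ⊗ₜ[k] f) := rfl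

/-- `f ↦ [m ⊗ f]` is `G`-equivariant. -/
theorem tmulMap_equivariant (m : M) (g : G) (f : MonoidAlgebra k (G ⧸ K)) :
    tmulMap k K M m (Representation.ofMulAction k G (G ⧸ K) g f) = inducedRep k K M g  (tmulMap k K M m f) := by
  rw [tmulMap_apply, tmulMap_apply, inducedRep_mk, tensorRep_tmul]

/-- `[m ⊗ T f] = [(m · T) ⊗ f]`. -/
theorem tmulMap_apply_apply (T : heckeAlgebra k K) (m : M) (f : MonoidAlgebra k (G ⧸ K)) :
    tmulMap k K M m ((T : Module.End k (MonoidAlgebra k (G ⧸ K))) f) =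
      tmulMap k K M (MulOpposite.op T • m) f := by
  rw [tmulMap_apply, tmulMap_apply, eq_comm, Submodule.Quotient.eq]
  exact tmul_sub_tmul_mem_rel k K M T m f

/-- THE HECKE ACTION ON `[M ⊗ δ_K]` IS THE MODULE STRUCTURE OF `M`:
`T • [m ⊗ δ_K] = [(m · T) ⊗ δ_K]`. -/
theorem heckeSMul_toInduced (T : heckeAlgebra k K) (m : M) :
    (heckeSMul  (inducedRep k K M) T ⟨toInduced k K M m, toInduced_mem_invariants k K M m⟩ : Induced k K M) =
      toInduced k K M (MulOpposite.op T • m) := by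
  rw [heckeSMul_coe]
  have hf : tmulMap k K M m ∈ equivariantHom (Representation.ofMulAction k G (G ⧸ K))  (inducedRep k K M) :=
    (mem_equivariantHom_iff _ _).2 (tmulMap_equivariant k K M m)
  have h := orbitLinear_apply_single_one  (inducedRep k K M) hf
  have e : orbitLinear  (inducedRep k K M)  (toInduced k K M m) (toInduced_mem_invariants k K M m) =
      tmulMap k K M m := h
  rw [e, tmulMap_apply_apply]
  rfl

end Construction

section Retraction

variable (k K) (M : Type*) [AddCommGroup M] [Module k M] [Module (heckeAlgebra k K)ᵐᵒᵖ M]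
  [IsScalarTower k (heckeAlgebra k K)ᵐᵒᵖ M]
  (hfin : ∀ g : G, Finite (MulAction.orbit K (g : G ⧸ K))) [CharZero k]

include hfin

/-- The bilinear map `(m, f) ↦ m · ε(f)`. -/
noncomputable def retractBilin : M →ₗ[k] MonoidAlgebra k (G ⧸ K) →ₗ[k] M :=
  LinearMap.mk₂ k (fun m f => MulOpposite.op (epsilon hfin f) • m)
    (fun m₁ m₂ f => smul_add _ _ _)
    (fun c m f => smul_comm _ _ _)
    (fun m f₁ f₂ => by rw [map_add, MulOpposite.op_add, add_smul])
    (fun c m f => by rw [map_smul, MulOpposite.op_smul, smul_assoc])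

/-- The value of the bilinear map on a pair. -/
theorem retractBilin_apply (m : M) (f : MonoidAlgebra k (G ⧸ K)) :
    retractBilin k K M hfin m f = MulOpposite.op (epsilon hfin f) • m := rfl

/-- The relations are killed by `m ⊗ f ↦ m · ε(f)`. -/
theorem rel_le_ker_lift :
    rel k K M ≤ LinearMap.ker (TensorProduct.lift  (retractBilin k K M hfin)) := by
  rw [rel, Submodule.span_le]
  rintro x ⟨T, m, f, rfl⟩
  rw [SetLike.mem_coe, LinearMap.mem_ker, map_sub, TensorProduct.lift.tmul, TensorProduct.lift.tmul,
    retractBilin_apply, retractBilin_apply, smul_smul, epsilon_apply, MulOpposite.op_mul, sub_self]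

/-- THE RETRACTION `X → M`, `[m ⊗ f] ↦ m · ε(f)`. -/
noncomputable def retract : Induced k K M →ₗ[k] M :=
   (rel k K M).liftQ (TensorProduct.lift  (retractBilin k K M hfin))  (rel_le_ker_lift k K M hfin)

/-- The retraction on a class `[m ⊗ f]`. -/
theorem retract_mk_tmul (m : M) (f : MonoidAlgebra k (G ⧸ K)) :
    retract k K M hfin (Submodule.Quotient.mk (m ⊗ₜ[k] f)) = MulOpposite.op (epsilon hfin f) • m := by
  rw [retract, Submodule.liftQ_apply, TensorProduct.lift.tmul, retractBilin_apply]

/-- `retract ∘ toInduced = id`: `m ↦ [m ⊗ δ_K]` is injective. -/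
theorem retract_toInduced (m : M) : retract k K M hfin  (toInduced k K M m) = m := by
  rw [toInduced_apply, retract_mk_tmul, epsilon_single_one, MulOpposite.op_one, one_smul]

/-- `m ↦ [m ⊗ δ_K]` is injective. -/
theorem toInduced_injective : Function.Injective  (toInduced k K M) :=
  Function.LeftInverse.injective  (retract_toInduced k K M hfin)

end Retraction

section Invariants

variable (k K) (M : Type*) [AddCommGroup M] [Module k M] [Module (heckeAlgebra k K)ᵐᵒᵖ M]
  [IsScalarTower k (heckeAlgebra k K)ᵐᵒᵖ M]
  (hfin : ∀ g : G, Finite (MulAction.orbit K (g : G ⧸ K))) [CharZero k]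

include hfin

omit [IsScalarTower k (heckeAlgebra k K)ᵐᵒᵖ M] [CharZero k] in
/-- `X` is `K`-finite when every double coset `KgK/K` is finite. -/
theorem kFinite_inducedRep : KFinite  (inducedRep k K M) K := by
  intro x
  induction x using Submodule.Quotient.induction_on with
  | H z =>
    induction z using TensorProduct.induction_on with
    | zero =>
      haveI : (stabilizerIn  (inducedRep k K M) K (Submodule.Quotient.mk 0)).FiniteIndex := by
        rw [Submodule.Quotient.mk_zero]
        rw [stabilizerIn_eq_top_iff.2 (Submodule.zero_mem _)]
        infer_instance
      exact this
    | tmul m f =>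
      haveI := kFinite_ofMulAction (k := k) hfin f
      refine Subgroup.finiteIndex_of_le (H := stabilizerIn (Representation.ofMulAction k G (G ⧸ K)) K f) ?_
      intro κ hκ
      rw [mem_stabilizerIn_iff] at hκ ⊢
      rw [← tmulMap_apply, ← tmulMap_equivariant, hκ]
    | add x y hx hy =>
      rw [Submodule.Quotient.mk_add]
      exact Subgroup.finiteIndex_of_le (inf_le_stabilizerIn_add K _ _)

omit [IsScalarTower k (heckeAlgebra k K)ᵐᵒᵖ M] in
/-- `e_K [m ⊗ f] = [m ⊗ e_K f] = [(m · ε(f)) ⊗ δ_K]`: the level average of a pure tensor lies in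
the image of `M`. -/
theorem levelAverage_mk_tmul (m : M) (f : MonoidAlgebra k (G ⧸ K)) :
    levelAverage  (inducedRep k K M) K (Submodule.Quotient.mk (m ⊗ₜ[k] f)) =
      toInduced k K M (MulOpposite.op (epsilon hfin f) • m) := by
  rw [← tmulMap_apply, ← map_levelAverage' (tmulMap_equivariant k K M m) (kFinite_ofMulAction hfin) f,
    ← epsilon_apply_single_one hfin f, tmulMap_apply_apply]
  rfl

omit [IsScalarTower k (heckeAlgebra k K)ᵐᵒᵖ M] in
/-- Every `K`-fixed vector of `X` is `[m ⊗ δ_K]` for some `m`. -/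
theorem exists_toInduced_eq {x : Induced k K M} (hx : x ∈ invariants  (inducedRep k K M) K) :
    ∃ m : M, toInduced k K M m = x := by
  have hx' : x = (levelIdempotentTo  (inducedRep k K M)  (kFinite_inducedRep k K M hfin) x : Induced k K M) := by
    rw [levelIdempotentTo_apply, levelAverage_of_mem_invariants hx]
  rw [hx']
  clear hx hx'
  induction x using Submodule.Quotient.induction_on with
  | H z =>
    induction z using TensorProduct.induction_on with
    | zero =>
      exact ⟨0, by rw [map_zero, Submodule.Quotient.mk_zero, map_zero, Submodule.coe_zero]⟩
    | tmul m f =>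
      refine ⟨MulOpposite.op (epsilon hfin f) • m, ?_⟩
      rw [levelIdempotentTo_apply, levelAverage_mk_tmul]
    | add x y hx hy =>
      obtain ⟨mx, hmx⟩ := hx
      obtain ⟨my, hmy⟩ := hy
      refine ⟨mx + my, ?_⟩
      rw [map_add, Submodule.Quotient.mk_add, map_add, Submodule.coe_add, hmx, hmy]

/-- `M ≃ X^K` as `k`-vector spaces, `m ↦ [m ⊗ δ_K]`. -/
noncomputable def invariantsEquiv : M ≃ₗ[k] invariants  (inducedRep k K M) K :=
  LinearEquiv.ofBijective ( (toInduced k K M).codRestrict _ (toInduced_mem_invariants k K M))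
    ⟨fun m₁ m₂ h => toInduced_injective k K M hfin (congrArg Subtype.val h),
      fun x => by
        obtain ⟨m, hm⟩ := exists_toInduced_eq k K M hfin x.2
        exact ⟨m, Subtype.ext hm⟩⟩

/-- The value of `M ≃ X^K` at `m` is `[m ⊗ δ_K]`. -/
theorem invariantsEquiv_apply (m : M) :
     (invariantsEquiv k K M hfin m : Induced k K M) = toInduced k K M m := rfl

/-- `M ≃ X^K` IS `H(G, K)`-LINEAR: the Hecke action on `X^K` is the module structure of `M`. -/
theorem heckeSMul_invariantsEquiv (T : heckeAlgebra k K) (m : M) :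
    heckeSMul  (inducedRep k K M) T  (invariantsEquiv k K M hfin m) =
      invariantsEquiv k K M hfin (MulOpposite.op T • m) := by
  apply Subtype.ext
  rw [invariantsEquiv_apply]
  exact heckeSMul_toInduced k K M T m

end Invariants

section Generation

variable (k K) (M : Type*) [AddCommGroup M] [Module k M] [Module (heckeAlgebra k K)ᵐᵒᵖ M]

/-- `X` is generated by `[M ⊗ δ_K]` as a `G`-representation: every class `[m ⊗ f]` lies in the
`G`-span of the image of `M`. -/
theorem mk_tmul_mem_gSpan (m : M) (f : MonoidAlgebra k (G ⧸ K)) :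
    Submodule.Quotient.mk (m ⊗ₜ[k] f) ∈
      gSpan  (inducedRep k K M) (LinearMap.range ( (toInduced k K M).codRestrict _ (toInduced_mem_invariants k K M))) := by
  have hf : tmulMap k K M m f =
      tmulMap k K M m (f.coeff.sum fun x c => MonoidAlgebra.single x c) := by
    rw [MonoidAlgebra.sum_coeff_single]
  rw [← tmulMap_apply, hf, map_finsuppSum]
  refine Submodule.finsuppSum_mem _ _ _ _ fun x _ => ?_
  have hs : MonoidAlgebra.single ((1 : G) : G ⧸ K) (f.coeff x) =
      f.coeff x • MonoidAlgebra.single ((1 : G) : G ⧸ K) (1 : k) := by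
    rw [MonoidAlgebra.smul_single, smul_eq_mul, mul_one]
  rw [single_eq_ofMulAction_out, tmulMap_equivariant, hs, map_smul, map_smul]
  have ht : tmulMap k K M m (MonoidAlgebra.single ((1 : G) : G ⧸ K) (1 : k)) = toInduced k K M m := rfl
  rw [ht]
  refine Submodule.smul_mem _ _ (apply_mem_gSpan _ _ _ ?_)
  rw [gSpan]
  apply Submodule.subset_span
  exact ⟨1, ⟨toInduced k K M m, toInduced_mem_invariants k K M m⟩, ⟨m, rfl⟩, by rw [map_one]; rfl⟩

end Generation

end Summit.Ventures.HodgeRepro2.T5HeckeInduced
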